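import Literature.AlgebraicGeometry.Resolution.ResolutionOfCurves
import Literature.AlgebraicGeometry.Resolution.RankOneReductionProofs
import Mathlib.RingTheory.AlgebraicIndependent.TranscendenceBasis
import HarnessLib

/-!
# Relative local uniformization of residue valuations when the residue field has
# transcendence degree `≤ 1`

Support file for crux stmt-ResolutionOfSingularities-16087 (`ValuativeSmoothing`, route file
`Theses/IndSmooth.lean`), line `birth`, stub `stub_relLUOfResidueTrdegLeOne` of the lead
skeleton (reshape r8).

* `stub_relLUOfResidueTrdegLeOne` — for a coarsening `O ≤ O₁` of valuation rings of `K ⊇ k`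
  such that any two elements of `O₁` satisfy a non-zero polynomial relation over `k` modulo
  `𝔪_{O₁}`, and any field `κ` over `k` mapping `k`-compatibly into the residue field `κ(O₁)`,
  the restriction to `κ` of the residue valuation ring `O / 𝔪_{O₁}` admits relative local
  uniformization over `k`. Indeed `κ` has transcendence degree `≤ 1` over `k` (an algebraically
  independent pair in `κ` would lift to a pair in `O₁` violating the hypothesis), and relative
  local uniformization holds for EVERY valuation ring of every `κ / k` of transcendence degree
  `≤ 1` (`relLocalUniformization_of_trdeg_le_one`, resolution of curves, PROVED in the tree).

## Sources

* J. Novacoski, M. Spivakovsky, *Reduction of local uniformization to the rank one case*,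
  EMS Ser. Congr. Rep. (2014), §2.1, Def. 2.20. [NovacoskiSpivakovsky2014]
* R. Hartshorne, *Algebraic Geometry*, GTM 52 (1977), Ch. V, Rem. 3.8.1 (curves are resolved by
  normalization).
-/

-- single-problem summit: the doubled namespace component is forced
set_option linter.dupNamespace false

namespace Summit.ResolutionOfSingularities.ResolutionOfSingularities.Theorems.ValuativeSmoothing

open IsLocalRing Literature.AlgebraicGeometry.Resolution

/-- If any two elements of a valuation ring `O₁ ⊇ k` of `K` satisfy a non-zero polynomial
relation over `k` modulo `𝔪_{O₁}`, then every field `κ` over `k` admitting a `k`-compatible ring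
map into the residue field `κ(O₁)` has transcendence degree `≤ 1` over `k`. [folklore] -/
theorem trdeg_le_one_of_residue_pairs_dependent (k K : Type) [Field k] [Field K] [Algebra k K]
    (O₁ : ValuationSubring K) (hk : ∀ c : k, algebraMap k K c ∈ O₁)
    (htr : ∀ x y : K, x ∈ O₁ → y ∈ O₁ → ∃ f : MvPolynomial (Fin 2) k, f ≠ 0 ∧
      O₁.valuation (MvPolynomial.aeval ![x, y] f) < 1)
    (κ : Type) [Field κ] [Algebra k κ] (ι : κ →+* ResidueField O₁)
    (hι : ∀ c : k, ι (algebraMap k κ c) = residue O₁ ⟨algebraMap k K c, hk c⟩) :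
    Algebra.trdeg k κ ≤ 1 := by
  -- the structure map `k → O₁`
  let φ₀ : k →+* O₁ :=
    { toFun := fun c => ⟨algebraMap k K c, hk c⟩
      map_one' := Subtype.ext (map_one _)
      map_mul' := fun a b => Subtype.ext (map_mul _ a b)
      map_zero' := Subtype.ext (map_zero _)
      map_add' := fun a b => Subtype.ext (map_add _ a b) }
  -- Step 1: `κ` contains no algebraically independent pair.
  have hpair : ∀ x : Fin 2 → κ, ¬ AlgebraicIndependent k x := by
    intro x hx
    obtain ⟨a, ha⟩ := IsLocalRing.residue_surjective (ι (x 0))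
    obtain ⟨b, hb⟩ := IsLocalRing.residue_surjective (ι (x 1))
    obtain ⟨f, hf0, hf⟩ := htr a b a.2 b.2
    refine hf0 (algebraicIndependent_iff.1 hx f (ι.injective ?_))
    rw [map_zero, MvPolynomial.map_aeval]
    have h1 : ι.comp (algebraMap k κ) = (residue O₁).comp φ₀ := RingHom.ext hι
    have h2 : (fun i => ι (x i)) = fun i => residue O₁ (![a, b] i) := by
      funext i
      fin_cases i
      · exact ha.symm
      · exact hb.symm
    rw [h1, h2, ← MvPolynomial.map_eval₂Hom, IsLocalRing.residue_eq_zero_iff,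
      ValuationSubring.valuation_lt_one_iff]
    convert hf using 2
    change O₁.subtype (MvPolynomial.eval₂Hom φ₀ ![a, b] f) = _
    rw [MvPolynomial.map_eval₂Hom, MvPolynomial.aeval_eq_eval₂Hom]
    refine MvPolynomial.eval₂Hom_congr (RingHom.ext fun _ => rfl) ?_ rfl
    funext i
    fin_cases i <;> rfl
  -- Step 2: hence every algebraically independent subset of `κ` is a subsingleton.
  rw [Algebra.trdeg]
  refine ciSup_le' fun s => ?_
  rw [Cardinal.mk_le_one_iff_set_subsingleton]
  intro a ha b hb
  by_contra hab
  have hinj : Function.Injective (![⟨a, ha⟩, ⟨b, hb⟩] : Fin 2 → s.1) := by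
    intro i j hij
    fin_cases i <;> fin_cases j
    · rfl
    · exact absurd (congrArg Subtype.val hij) hab
    · exact absurd (congrArg Subtype.val hij).symm hab
    · rfl
  exact hpair _ (s.2.comp _ hinj)

/-- **Relative local uniformization of residue valuations in residue transcendence degree
`≤ 1`.** Let `O ≤ O₁` be valuation rings of `K ⊇ k` with `k ⊆ O₁`, such that any two elements
of `O₁` satisfy a non-zero polynomial relation over `k` modulo `𝔪_{O₁}` (the residue field of
`O₁` has transcendence degree `≤ 1` over `k`). Then for every field `κ` over `k` with a
`k`-compatible ring map `ι : κ → κ(O₁)`, the restriction along `ι` of the residue valuation ring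
`O / 𝔪_{O₁} ⊆ κ(O₁)` admits relative local uniformization over `k`: `κ` has transcendence
degree `≤ 1` over `k` (`trdeg_le_one_of_residue_pairs_dependent`), and local uniformization in
dimension one is PROVED (`relLocalUniformization_of_trdeg_le_one`, from resolution of curves by
normalization). [cite: NovacoskiSpivakovsky2014, Def. 2.20] -/
theorem stub_relLUOfResidueTrdegLeOne (k K : Type) [Field k] [Field K] [Algebra k K]
    (O O₁ : ValuationSubring K) (hO : O ≤ O₁) (hk : ∀ c : k, algebraMap k K c ∈ O₁)
    (htr : ∀ x y : K, x ∈ O₁ → y ∈ O₁ → ∃ f : MvPolynomial (Fin 2) k, f ≠ 0 ∧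
      O₁.valuation (MvPolynomial.aeval ![x, y] f) < 1)
    (κ : Type) [Field κ] [Algebra k κ] (ι : κ →+* IsLocalRing.ResidueField O₁)
    (hι : ∀ c : k, ι (algebraMap k κ c) = IsLocalRing.residue O₁ ⟨algebraMap k K c, hk c⟩) :
    RelLocalUniformization k κ ((residueValuationSubring O O₁ hO).comap ι) :=
  relLocalUniformization_of_trdeg_le_one k κ
    (trdeg_le_one_of_residue_pairs_dependent k K O₁ hk htr κ ι hι) _

end Summit.ResolutionOfSingularities.ResolutionOfSingularities.Theorems.ValuativeSmoothing
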